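import Literature.NumberTheory.LFunctions.ZetaScrewThm17Proofs
import HarnessLib

/-!
# Suzuki's Theorem 1.2 (RH ⟺ `−Ψ` is a screw function on `ℝ`): proof

Sibling proofs file (D-0014 append protocol) of `Literature/NumberTheory/LFunctions/ZetaScrew.lean`.

M. Suzuki, *Aspects of the screw function corresponding to the Riemann zeta-function*,
J. Lond. Math. Soc. (2) 108 (2023) 1448–1487 = arXiv:2206.03682 [Suzuki2023], Theorem 1.2:
RH holds iff `g = -Ψ` is a screw function on `ℝ`, i.e. iff the kernel
`G_g(t,u) = Ψ(t) + Ψ(u) - Ψ(t - u)` is non-negative definite on `ℝ` in the sense (1.5) — the named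
fact `Literature.NumberTheory.LFunctions.Suzuki2023_thm12`, discharged here as
`Suzuki2023_thm12_holds`.

In the paper Thm 1.2 is obtained from Thm 1.1 (1) through the Kreĭn–Langer correspondence
`𝒢_∞ ↔ 𝒩` and Lagarias' Nevanlinna-class criterion for RH.  Here both implications are taken along
the elementary roads the paper itself points out, on top of the tree's discharges of Thm 1.1
(`Suzuki2023_thm11_fourier_holds`, `ZetaScrewLaplace.lean`; `Suzuki2023_thm11_series_holds`,
`ZetaScrewSeriesProofs.lean`) and of Thm 1.7 (`ZetaScrewThm17Proofs.lean`):

* **RH ⇒ `G_g ≥ 0`** (`Suzuki2023_thm12_mp`): under RH every zero is `ρ = ½ + iγ`, `γ ∈ ℝ`, and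
  Thm 1.1 (2) reads `Ψ(t) = ∑_ρ m(ρ) (1 − cos γt)/γ²` (`ZetaScrewThm17.hasSum_real`); hence the
  real form of Suzuki2023 (1.9),
  `∑ᵢⱼ xᵢ xⱼ G_g(tᵢ,tⱼ) = ∑_ρ m(ρ) γ⁻² [(∑ᵢ xᵢ (1 − cos γtᵢ))² + (∑ᵢ xᵢ sin γtᵢ)²] ≥ 0`
  (`ZetaScrewThm12.sum_sum_kernel_nonneg`), which is non-negative definiteness on `ℝ` by
  `isPosSemidefKernelOn_zetaScrewKernel_iff` (p. 4 of the paper: "(1.9) … `G_g(t,u)` is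
  non-negative on `ℝ²` under the RH").
* **`G_g ≥ 0` ⇒ RH** (`Suzuki2023_thm12_mpr`): the one-point configurations give
  `G_g(t,t) = 2Ψ(t) ≥ 0` (p. 4 of the paper, `zetaScrew_nonneg_of_isPosSemidefKernelOn`), and
  `Ψ ≥ 0` on `ℝ` implies RH — the sufficiency half of Thm 1.7 (§7.2: Landau's theorem for the
  Laplace transform (1.2) of the non-negative `Ψ`), `riemannHypothesis_of_zetaScrew_nonneg` of
  `ZetaScrewThm17Proofs.lean`.

## References

* M. Suzuki, J. Lond. Math. Soc. (2) 108 (2023), no. 4, 1448–1487; arXiv:2206.03682, Thm 1.1,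
  Thm 1.2, (1.5), (1.9), Thm 1.7, §7.2. [Suzuki2023]
-/

noncomputable section

open Complex Filter Topology Set
open scoped Real BigOperators

open Literature.Analysis.Complex (IsPosSemidefKernelOn)

namespace Literature.NumberTheory.LFunctions

namespace ZetaScrewThm12

/-! ## RH ⇒ non-negative definiteness of `G_g` (Suzuki2023 (1.9)) -/

/-- Under RH the kernel is the real series
`G_g(t,u) = ∑_ρ m(ρ) γ⁻² (1 − cos γt − cos γu + cos γ(t − u))`, `γ = Im ρ` — the real form of
Suzuki2023 (1.9), from Thm 1.1 (2) on the critical line (`ZetaScrewThm17.hasSum_real`).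
[cite: Suzuki2023, (1.9)] -/
theorem hasSum_kernel (hRH : RiemannHypothesis) (t u : ℝ) :
    HasSum (fun ρ : ZetaZeros.riemannZetaNontrivialZeros ↦
      (riemannZetaZeroOrder (ρ : ℂ) : ℝ) / (ρ : ℂ).im ^ 2 *
        (1 - Real.cos ((ρ : ℂ).im * t) - Real.cos ((ρ : ℂ).im * u)
          + Real.cos ((ρ : ℂ).im * t - (ρ : ℂ).im * u)))
      (zetaScrewKernel t u) := by
  have h := ((ZetaScrewThm17.hasSum_real hRH t).add (ZetaScrewThm17.hasSum_real hRH u)).sub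
    (ZetaScrewThm17.hasSum_real hRH (t - u))
  have hfun : (fun ρ : ZetaZeros.riemannZetaNontrivialZeros ↦
      (riemannZetaZeroOrder (ρ : ℂ) : ℝ) / (ρ : ℂ).im ^ 2 *
        (1 - Real.cos ((ρ : ℂ).im * t) - Real.cos ((ρ : ℂ).im * u)
          + Real.cos ((ρ : ℂ).im * t - (ρ : ℂ).im * u))) =
      fun ρ : ZetaZeros.riemannZetaNontrivialZeros ↦
        (riemannZetaZeroOrder (ρ : ℂ) : ℝ) * ((1 - Real.cos ((ρ : ℂ).im * t)) / (ρ : ℂ).im ^ 2)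
        + (riemannZetaZeroOrder (ρ : ℂ) : ℝ) * ((1 - Real.cos ((ρ : ℂ).im * u)) / (ρ : ℂ).im ^ 2)
        - (riemannZetaZeroOrder (ρ : ℂ) : ℝ) *
            ((1 - Real.cos ((ρ : ℂ).im * (t - u))) / (ρ : ℂ).im ^ 2) := by
    funext ρ
    rw [mul_sub]
    ring
  rw [zetaScrewKernel, hfun]
  exact h

/-- **Suzuki2023 (1.9), positivity.** Under RH every real quadratic form of the kernel is
`∑ᵢⱼ xᵢ xⱼ G_g(tᵢ,tⱼ) = ∑_ρ m(ρ) γ⁻² [(∑ᵢ xᵢ(1 − cos γtᵢ))² + (∑ᵢ xᵢ sin γtᵢ)²] ≥ 0`.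
[cite: Suzuki2023, (1.9)] -/
theorem sum_sum_kernel_nonneg (hRH : RiemannHypothesis) {N : ℕ} (t x : Fin N → ℝ) :
    0 ≤ ∑ i, ∑ j, zetaScrewKernel (t i) (t j) * (x i * x j) := by
  have hQ : HasSum (fun ρ : ZetaZeros.riemannZetaNontrivialZeros ↦ ∑ i, ∑ j,
      (riemannZetaZeroOrder (ρ : ℂ) : ℝ) / (ρ : ℂ).im ^ 2 *
        (1 - Real.cos ((ρ : ℂ).im * t i) - Real.cos ((ρ : ℂ).im * t j)
          + Real.cos ((ρ : ℂ).im * t i - (ρ : ℂ).im * t j)) * (x i * x j))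
      (∑ i, ∑ j, zetaScrewKernel (t i) (t j) * (x i * x j)) :=
    hasSum_sum fun i _ ↦ hasSum_sum fun j _ ↦ (hasSum_kernel hRH (t i) (t j)).mul_right _
  refine hQ.nonneg fun ρ ↦ ?_
  set γ : ℝ := (ρ : ℂ).im with hγ
  set m : ℝ := (riemannZetaZeroOrder (ρ : ℂ) : ℝ) with hm
  have key : ∑ i, ∑ j, m / γ ^ 2 *
      (1 - Real.cos (γ * t i) - Real.cos (γ * t j) + Real.cos (γ * t i - γ * t j)) * (x i * x j)
      = m / γ ^ 2 * ((∑ i, x i * (1 - Real.cos (γ * t i))) * (∑ i, x i * (1 - Real.cos (γ * t i)))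
          + (∑ i, x i * Real.sin (γ * t i)) * (∑ i, x i * Real.sin (γ * t i))) := by
    simp_rw [Real.cos_sub]
    rw [Finset.sum_mul_sum, Finset.sum_mul_sum, ← Finset.sum_add_distrib, Finset.mul_sum]
    refine Finset.sum_congr rfl fun i _ ↦ ?_
    rw [← Finset.sum_add_distrib, Finset.mul_sum]
    refine Finset.sum_congr rfl fun j _ ↦ ?_
    ring
  rw [key]
  have hm0 : 0 ≤ m := by
    rw [hm]
    have hρ1 : (ρ : ℂ) ≠ 1 := fun h ↦ by
      have h0 : riemannZeta (ρ : ℂ) = 0 := ρ.2.1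
      rw [h] at h0
      exact riemannZeta_one_ne_zero h0
    exact_mod_cast riemannZetaZeroOrder_nonneg hρ1
  exact mul_nonneg (div_nonneg hm0 (sq_nonneg _))
    (add_nonneg (mul_self_nonneg _) (mul_self_nonneg _))

end ZetaScrewThm12

/-- **Suzuki2023 Thm 1.2, necessity.** If RH holds then the kernel `G_g(t,u) = Ψ(t) + Ψ(u) − Ψ(t − u)`
of `g = −Ψ` is non-negative definite on `ℝ` (Suzuki2023 p. 4: by (1.9) "the kernel `G_g(t,u)` is
non-negative on `ℝ²` under the RH"). [cite: Suzuki2023, Thm 1.2 and (1.9)] -/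
theorem Suzuki2023_thm12_mp (hRH : RiemannHypothesis) :
    IsPosSemidefKernelOn (fun t u : ℝ ↦ (zetaScrewKernel t u : ℂ)) Set.univ :=
  (isPosSemidefKernelOn_zetaScrewKernel_iff _).2 fun _ t x _ ↦
    ZetaScrewThm12.sum_sum_kernel_nonneg hRH t x

/-- One-point configurations: `G_g ≥ 0` on `ℝ` gives `Ψ ≥ 0` on `ℝ` (Suzuki2023 p. 4,
"`G_g(t,t) = 2Ψ(t)` is non-negative by (1.5) for `n = 1` and `ξ = 1`"). [cite: Suzuki2023, p. 4] -/
theorem zetaScrew_nonneg_of_isPosSemidefKernelOn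
    (hpsd : IsPosSemidefKernelOn (fun t u : ℝ ↦ (zetaScrewKernel t u : ℂ)) Set.univ) (t : ℝ) :
    0 ≤ zetaScrew t :=
  zetaScrew_nonneg_of_sum_nonneg ((isPosSemidefKernelOn_zetaScrewKernel_iff _).1 hpsd)
    (Set.mem_univ t)

/-- **Suzuki2023 Thm 1.2, sufficiency.** If `G_g` is non-negative definite on `ℝ` then RH holds:
`Ψ ≥ 0` by the one-point configurations, and `Ψ ≥ 0` implies RH by the sufficiency half of
Thm 1.7 (`riemannHypothesis_of_zetaScrew_nonneg`: Landau's theorem applied to the Laplace transform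
(1.2) of `Ψ`, §7.2 of the paper). [cite: Suzuki2023, Thm 1.2; Thm 1.7, §7.2] -/
theorem Suzuki2023_thm12_mpr
    (hpsd : IsPosSemidefKernelOn (fun t u : ℝ ↦ (zetaScrewKernel t u : ℂ)) Set.univ) :
    RiemannHypothesis :=
  riemannHypothesis_of_zetaScrew_nonneg (zetaScrew_nonneg_of_isPosSemidefKernelOn hpsd)

/-- **Discharge of `Suzuki2023_thm12`** (Suzuki2023 Thm 1.2): RH holds if and only if `g = −Ψ` is a
screw function on `ℝ`, i.e. iff `G_g(t,u) = Ψ(t) + Ψ(u) − Ψ(t − u)` is a non-negative definite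
kernel on `ℝ`. [cite: Suzuki2023, Thm 1.2] -/
theorem Suzuki2023_thm12_holds : Suzuki2023_thm12 :=
  ⟨Suzuki2023_thm12_mp, Suzuki2023_thm12_mpr⟩

end Literature.NumberTheory.LFunctions
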